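import Summits.Ventures.QEC.Census.CertBZPlane
import Summits.Ventures.QEC.Census.TwoBGA.A2h_n240_k16_77e10a56.Cert
import Summits.Ventures.QEC.Census.TwoBGA.A2h_n240_k16_77e10a56.OrbitZ
import Summits.Ventures.QEC.Census.TwoBGA.A2h_n240_k16_77e10a56.OrbitX
import HarnessLib

/-!
# `A2h_n240_k16_77e10a56` — lane-engine replays, part 10/12 (census row `A2h_n240_k16_77e10a56`; qec-search-4 orbit lane, emitted by qec-type-08 g7)

`Plane.segOK` verdicts (type-01 lane engine, `decide +kernel`) for segments of the kernel-basis replays of the views of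
`Census/TwoBGA/A2h_n240_k16_77e10a56/`; assembled in `Distance.lean`.  Generated by `tools/gen4/emit_orbit_row.py`; do not edit by hand.
-/

set_option autoImplicit false
set_option Elab.async false

namespace Summit.Ventures.QEC.Census.A2h_n240_k16_77e10a56

open Summit.Ventures.QEC.Census

set_option maxHeartbeats 400000000 in
/-- `X` view 0, lane segment `[116, 117)` (7420492 lanes, depth 5, threshold 11; est 24 s): every selection with largest row there passes (lane engine, KERNEL). -/
theorem psegX_0_32 : Plane.segOK 240 11 (A2h_n240_k16_77e10a56.cert.sideX.found.map Prod.fst) A2h_n240_k16_77e10a56.pGX_0 5 116 1 38 = true := by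
  decide +kernel

set_option maxHeartbeats 400000000 in
/-- `X` view 0, lane segment `[117, 118)` (7680739 lanes, depth 5, threshold 11; est 24 s): every selection with largest row there passes (lane engine, KERNEL). -/
theorem psegX_0_33 : Plane.segOK 240 11 (A2h_n240_k16_77e10a56.cert.sideX.found.map Prod.fst) A2h_n240_k16_77e10a56.pGX_0 5 117 1 38 = true := by
  decide +kernel

set_option maxHeartbeats 400000000 in
/-- `X` view 0, lane segment `[118, 119)` (7947773 lanes, depth 5, threshold 11; est 28 s): every selection with largest row there passes (lane engine, KERNEL). -/
theorem psegX_0_34 : Plane.segOK 240 11 (A2h_n240_k16_77e10a56.cert.sideX.found.map Prod.fst) A2h_n240_k16_77e10a56.pGX_0 5 118 1 38 = true := by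
  decide +kernel

set_option maxHeartbeats 400000000 in
/-- `X` view 0, lane segment `[119, 120)` (8221711 lanes, depth 5, threshold 11; est 30 s): every selection with largest row there passes (lane engine, KERNEL). -/
theorem psegX_0_35 : Plane.segOK 240 11 (A2h_n240_k16_77e10a56.cert.sideX.found.map Prod.fst) A2h_n240_k16_77e10a56.pGX_0 5 119 1 38 = true := by
  decide +kernel

set_option maxHeartbeats 400000000 in
/-- `X` view 0, lane segment `[120, 121)` (8502671 lanes, depth 5, threshold 11; est 33 s): every selection with largest row there passes (lane engine, KERNEL). -/
theorem psegX_0_36 : Plane.segOK 240 11 (A2h_n240_k16_77e10a56.cert.sideX.found.map Prod.fst) A2h_n240_k16_77e10a56.pGX_0 5 120 1 38 = true := by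
  decide +kernel

set_option maxHeartbeats 400000000 in
/-- `X` view 0, lane segment `[121, 122)` (8790772 lanes, depth 5, threshold 11; est 35 s): every selection with largest row there passes (lane engine, KERNEL). -/
theorem psegX_0_37 : Plane.segOK 240 11 (A2h_n240_k16_77e10a56.cert.sideX.found.map Prod.fst) A2h_n240_k16_77e10a56.pGX_0 5 121 1 38 = true := by
  decide +kernel

end Summit.Ventures.QEC.Census.A2h_n240_k16_77e10a56
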